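import Literature.AlgebraicGeometry.FundamentalGroup.RiemannExistenceLineProjection
import Literature.RingTheory.KrullDimension.AffineDimension
import Literature.AlgebraicGeometry.Motives.CyclesDimensionProofs
import Mathlib.RingTheory.NoetherNormalization
import HarnessLib

/-!
# Noether normalisation of a smooth affine curve: a finite projection to the line

Layer `Literature/AlgebraicGeometry/FundamentalGroup`, an input of the curve case of Riemann's
existence theorem (SGA1 XII Thm. 5.1). For `S` an affine integral `ℂ`-scheme, smooth of relative
dimension `1`, there is `f ∈ A = Γ(S, 𝒪_S)` such that `A` is module-finite over `ℂ[f]`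
(`exists_finite_eval₂RingHom`): Noether normalisation (Mathlib's `exists_finite_inj_algHom_of_fg`:
`A` is finite over an injective image of `ℂ[x₁, …, x_s]`) with `s = dim A`
(`Literature.RingTheory.KrullDimension.ringKrullDim_eq_of_isIntegral`,
`MvPolynomial.ringKrullDim_of_isNoetherianRing`), and `dim A = dim S = 1` for the affine scheme `S`
(`ringKrullDim_sections_eq_krullDim`: `S ≅ Spec A` is a homeomorphism, hence an isomorphism of
specialisation orders; the tree's `krullDim_eq_of_smoothOfRelativeDimension`).

Everything is proved; there are no definitions.

## References

* D. Eisenbud, *Commutative Algebra with a View Toward Algebraic Geometry*, GTM 150 (1995),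
  Thm. 13.3 (Noether normalisation) and Cor. 13.4 / Thm. A. [Eisenbud1995]
* A. Grothendieck, M. Raynaud, *SGA 1*, Exp. XII Thm. 5.1. [SGA1]
-/

noncomputable section

open CategoryTheory AlgebraicGeometry Polynomial Order
open Literature.AlgebraicGeometry.Motives

universe u

namespace Literature.AlgebraicGeometry.FundamentalGroup

namespace LineProjection

variable (S : SchemeOver ℂ)

/-- **`dim Γ(S, 𝒪_S) = dim S` for an affine scheme**: `S ≅ Spec Γ(S, 𝒪_S)` is a homeomorphism, hence
an isomorphism of the specialisation orders. [folklore] -/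
theorem ringKrullDim_sections_eq_krullDim [IsAffine S.left] :
    ringKrullDim Γ(S.left, ⊤) = Order.krullDim S.left := by
  set h : S.left ≃ₜ (Spec Γ(S.left, ⊤) : Scheme) := Scheme.homeoOfIso S.left.isoSpec with hh
  -- the homeomorphism is an order isomorphism for the specialisation orders
  let e : S.left ≃o (Spec Γ(S.left, ⊤) : Scheme) :=
    { toEquiv := h.toEquiv
      map_rel_iff' := by
        intro a b
        simp only [Scheme.le_iff_specializes]
        exact h.isInducing.specializes_iff }
  rw [← Order.krullDim_eq_of_orderIso e.symm, Order.krullDim_eq_of_orderIso (AlgebraicGeometry.specOrderIsoPrimeSpectrum _),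
    krullDim_orderDual]
  rfl

/-- **`dim Γ(S, 𝒪_S) = 1`** for `S` affine, smooth of relative dimension `1` over `ℂ` and non-empty.
[cite: GortzWedhorn2020, Lemma 6.26 and Lemma 5.7 (4)] -/
theorem ringKrullDim_sections_eq_one [IsAffine S.left] [SmoothOfRelativeDimension 1 S.hom] [Nonempty S.left] :
    ringKrullDim Γ(S.left, ⊤) = 1 := by
  rw [ringKrullDim_sections_eq_krullDim, krullDim_eq_of_smoothOfRelativeDimension S.hom 1]
  rfl

/-- `ℂ[t] → ℂ[x₀]`, `t ↦ x₀`, is onto. [folklore] -/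
theorem eval₂RingHom_C_X_surjective :
    Function.Surjective (eval₂RingHom (MvPolynomial.C : ℂ →+* MvPolynomial (Fin 1) ℂ) (MvPolynomial.X 0)) := by
  intro p
  induction p using MvPolynomial.induction_on with
  | C a => exact ⟨C a, by rw [coe_eval₂RingHom, eval₂_C]⟩
  | add p q hp hq =>
    obtain ⟨p', rfl⟩ := hp
    obtain ⟨q', rfl⟩ := hq
    exact ⟨p' + q', map_add _ _ _⟩
  | mul_X p i hp =>
    obtain ⟨p', rfl⟩ := hp
    refine ⟨p' * X, ?_⟩
    rw [map_mul, coe_eval₂RingHom, eval₂_X, Fin.fin_one_eq_zero i]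

/-- **Noether normalisation of a smooth affine curve**: there is `f ∈ Γ(S, 𝒪_S)` over which
`Γ(S, 𝒪_S)` is module-finite, `ℂ[t] → Γ(S, 𝒪_S)`, `t ↦ f`. [cite: Eisenbud1995, Thm. 13.3 and Cor. 13.4] -/
theorem exists_finite_eval₂RingHom [IsAffine S.left] [LocallyOfFiniteType S.hom] [SmoothOfRelativeDimension 1 S.hom]
    [IsIntegral S.left] :
    ∃ f : Γ(S.left, ⊤), (eval₂RingHom (structureMap S) f).Finite := by
  classical
  haveI : Nonempty S.left := IsIntegral.nonempty
  haveI : Nonempty (⊤ : S.left.Opens) := ⟨⟨(IsIntegral.nonempty (X := S.left)).some, trivial⟩⟩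
  letI algC : Algebra ℂ Γ(S.left, ⊤) := (structureMap S).toAlgebra
  haveI hft : Algebra.FiniteType ℂ Γ(S.left, ⊤) := finiteType_structureMap S
  obtain ⟨s, g, hinj, hfin⟩ := exists_finite_inj_algHom_of_fg ℂ Γ(S.left, ⊤)
  -- `s = 1` by comparing Krull dimensions
  have hs : s = 1 := by
    letI alg : Algebra (MvPolynomial (Fin s) ℂ) Γ(S.left, ⊤) := g.toRingHom.toAlgebra
    haveI : Module.Finite (MvPolynomial (Fin s) ℂ) Γ(S.left, ⊤) := hfin
    haveI : Algebra.IsIntegral (MvPolynomial (Fin s) ℂ) Γ(S.left, ⊤) := Algebra.IsIntegral.of_finite _ _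
    have hinj' : Function.Injective (algebraMap (MvPolynomial (Fin s) ℂ) Γ(S.left, ⊤)) := hinj
    have hdim := Literature.RingTheory.KrullDimension.ringKrullDim_eq_of_isIntegral hinj'
    rw [MvPolynomial.ringKrullDim_of_isNoetherianRing, ringKrullDim_eq_zero_of_field, Nat.card_eq_fintype_card,
      Fintype.card_fin, zero_add, ringKrullDim_sections_eq_one] at hdim
    exact_mod_cast hdim
  subst hs
  -- `f := g(x₀)`; `ℂ[t] → Γ(S, 𝒪_S)` factors as `ℂ[t] ↠ ℂ[x₀] → Γ(S, 𝒪_S)`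
  refine ⟨g (MvPolynomial.X 0), ?_⟩
  have hcomp : g.toRingHom.comp (eval₂RingHom (MvPolynomial.C : ℂ →+* MvPolynomial (Fin 1) ℂ) (MvPolynomial.X 0)) =
      eval₂RingHom (structureMap S) (g (MvPolynomial.X 0)) := by
    refine Polynomial.ringHom_ext (fun c ↦ ?_) ?_
    · rw [RingHom.comp_apply, coe_eval₂RingHom, eval₂_C, coe_eval₂RingHom, eval₂_C, AlgHom.toRingHom_eq_coe,
        RingHom.coe_coe, ← MvPolynomial.algebraMap_eq, g.commutes]
      rfl
    · rw [RingHom.comp_apply, coe_eval₂RingHom, eval₂_X, coe_eval₂RingHom, eval₂_X]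
      rfl
  rw [← hcomp]
  exact RingHom.Finite.comp hfin (RingHom.Finite.of_surjective _ eval₂RingHom_C_X_surjective)

end LineProjection

end Literature.AlgebraicGeometry.FundamentalGroup
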